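import Summits.ResolutionOfSingularities.ResolutionOfSingularities.Theorems.MarkedTransferCampaignW46WWalkNRThread
import HarnessLib

/-!
# [OURS · L1 W4.6 rung (iii-2), NON-RATIONAL W-WALK, brick 7] DESCENT of a rational `T`-tail to the coefficient field of its first point
# (pv-5's door closes it), DEFECT PERSISTENCE on the plateau, and the SHADOW anchor

Cell `res-hironaka`, LADDER-RESOLUTION rung L (D-0089), slot W4.6 rung (iii); seat res-L1-s46-pv-6 (gen 8). Host route MarkedTransfer,
`--supports stmt-ResolutionOfSingularities-16155 --as helper`; kind proof (no definition).

WHAT (the three tools of the tail argument `…WWalkNRTail`):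
* `false_of_rational_tail` — DESCENT: a `T`-tail of the `Ω`-model whose digits `l_n` and cleaning roots `γ_n` are RATIONAL over the coefficient
  subfields (`l_n ∈ Λ_n`, hence `Λ_n ≤ Λ_M` and all data in `Λ_M = ι(L)`) is the base change of a `T`-tail in `L⟦t,y,z⟧` starting at the anchor's
  own residual; res-L1-s46-pv-5's `false_of_tTail` and the door `…WWalkNRPoint.exists_door_of_wAnchor` (any coefficient field) close it.
* `defect_step` — DEFECT PERSISTENCE on the `σ = p` plateau (model level, any field): if the degree-`D` form of `g` has no monomial of `z`-exponent
  `< p` (boundary `t^{D−p}`, no `y`-letter) and the next TWO steps stall at order `D`, then the same holds for `g′ = stepT p l γ g`, with the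
  same corner coefficient `[t^{D−p} z^p] g′ = [t^{D−p} z^p] g` (`…WWalkNRBaseChange.coeff_eq_zero_of_layer_of_stall` + the layer formula).
* `lowVanish_shadow`, `shadow_eq`, `bdiv_shadow`, `exists_shadow_anchor`, `map_inv_eq` — the SHADOW residual `(z^p + g)·u⁻¹ − z^p`,
  `u = 1 + c₀ t^{R}`: order `≥ D + 1` when the degree-`D` form of `g` is `c₀ t^R z^p`, boundary kept, and a `w`-anchor over the same field.

HONEST FRAMING. OURS; nothing here is a statement of H. Hironaka's manuscript [Hironaka2017] and nothing of it is used. AI-written;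
AI review is weaker than expert review. No `sorry`; axioms standard. [cite: StacksProject, Tag 00DV] (the door) [cite: Hauser2010, §§F–G] [folklore]
-/

noncomputable section

set_option linter.dupNamespace false -- mandated namespace of this single-conjunct summit

open MvPowerSeries IsLocalRing Finset
open Literature.AlgebraicGeometry.Resolution
open Literature.RingTheory.MvPowerSeries.Jets (mem_maximalIdeal_iff_constantCoeff_eq_zero mem_maximalIdeal_pow_iff)

namespace Summit.ResolutionOfSingularities.ResolutionOfSingularities.Theorems

namespace CampaignW46

namespace WWalkNR

open CategoryTheory AlgebraicGeometry TopologicalSpace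
open Literature.AlgebraicGeometry.Hironaka2017.S02Preliminaries
open Literature.AlgebraicGeometry.Hironaka2017.Datum
open Scheme.IdealSheafData
open WWalk

/-! ## §1 Model algebra: defect persistence and the shadow residual -/

section Model

variable {K : Type*} [Field K]

/-- Coefficients of `c · t^R z^p`. [folklore] -/
theorem coeff_C_mul_X_pow_mul_X_pow (c : K) (R p a b cz : ℕ) :
    coeff (mk3 a b cz) (MvPowerSeries.C c * X (some 0) ^ R * X none ^ p : MvPowerSeries (Option (Fin 2)) K) =
      if a = R ∧ b = 0 ∧ cz = p then c else 0 := by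
  classical
  have hexp : Finsupp.single (some (0 : Fin 2)) R + Finsupp.single (none : Option (Fin 2)) p = mk3 R 0 p := by
    ext o
    rcases o with _ | k
    · simp [mk3]
    · fin_cases k <;> simp [mk3]
  have hmon : (X (some 0) ^ R * X none ^ p : MvPowerSeries (Option (Fin 2)) K) = monomial (mk3 R 0 p) 1 := by
    rw [X_pow_eq, X_pow_eq, monomial_mul_monomial, one_mul, hexp]
  rw [mul_assoc, hmon, coeff_C_mul, coeff_monomial]
  by_cases h : a = R ∧ b = 0 ∧ cz = p
  · rw [if_pos (mk3_inj.mpr h), if_pos h, mul_one]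
  · rw [if_neg (fun h' => h (mk3_inj.mp h')), if_neg h, mul_zero]

/-- **The shadow residual has order `≥ D + 1`**: if `g` has `LowVanish D`, all degree-`D` coefficients other than `[t^R z^p] g = c₀` vanish
(`R + p = D`), then `g − c₀ t^R z^p` has no monomial of degree `≤ D`. [folklore] -/
theorem lowVanish_sub_corner {D R p : ℕ} (hRD : R + p = D) {g : MvPowerSeries (Option (Fin 2)) K} (hlow : LowVanish D g) {c₀ : K}
    (hdef : ∀ a b cz, a + b + cz = D → ¬ (a = R ∧ b = 0 ∧ cz = p) → coeff (mk3 a b cz) g = 0) (hc₀ : coeff (mk3 R 0 p) g = c₀) :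
    LowVanish (D + 1) (g - MvPowerSeries.C c₀ * X (some 0) ^ R * X none ^ p) := by
  intro e he
  rw [← mk3_eta e, map_sub, coeff_C_mul_X_pow_mul_X_pow]
  rw [degree_eq] at he
  by_cases hD : e (some 0) + e (some 1) + e none = D
  · by_cases h : e (some 0) = R ∧ e (some 1) = 0 ∧ e none = p
    · rw [if_pos h, h.1, h.2.1, h.2.2, hc₀, sub_self]
    · rw [if_neg h, hdef _ _ _ hD h, sub_zero]
  · rw [hlow _ (by rw [degree_mk3]; omega), if_neg (fun h => hD (by rw [h.1, h.2.1, h.2.2]; omega)), sub_zero]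

/-- The shadow residual rewritten: `(z^p + g)·v − z^p = (g − (u − 1) z^p)·v` when `u v = 1`. [folklore] -/
theorem shadow_eq {p : ℕ} (g u v : MvPowerSeries (Option (Fin 2)) K) (huv : u * v = 1) :
    (X none ^ p + g) * v - X none ^ p = (g - (u - 1) * X none ^ p) * v := by
  have h1 : (X none : MvPowerSeries (Option (Fin 2)) K) ^ p = X none ^ p * u * v := by rw [mul_assoc, huv, mul_one]
  conv_lhs => rw [show (X none ^ p + g) * v - X none ^ p = (X none ^ p + g) * v - X none ^ p * u * v by rw [← h1]]
  ring

/-- **DEFECT PERSISTENCE ON THE PLATEAU (one step).** Boundary `t^{D−p}`, no `y`-letter, orders `D` at this stage, the next and the one after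
(two stalls), `p + 1 ≤ D ≤ 2p − 1`: if the degree-`D` form of `g` has no monomial of `z`-exponent `< p`, then neither has that of
`g′ = stepT p l γ g`, and the corner coefficient `[t^{D−p} z^p]` is unchanged. [cite: Hauser2010, §F] -/
theorem defect_step {p D : ℕ} (hpd : p + 1 ≤ D) (hd2 : D ≤ 2 * p - 1) {g : MvPowerSeries (Option (Fin 2)) K} (hlow : LowVanish D g)
    (hB : BDiv (D - p) 0 g) (l γ : K) (hlow' : LowVanish D (stepT p l γ g)) (hB' : BDiv (D - p) 0 (stepT p l γ g)) (l' γ' : K)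
    (hlow'' : LowVanish D (stepT p l' γ' (stepT p l γ g))) (hdef : ∀ a b cz, a + b + cz = D → cz < p → coeff (mk3 a b cz) g = 0) :
    (∀ a b cz, a + b + cz = D → cz < p → coeff (mk3 a b cz) (stepT p l γ g) = 0) ∧
      coeff (mk3 (D - p) 0 p) (stepT p l γ g) = coeff (mk3 (D - p) 0 p) g := by
  classical
  -- the `t^{D-p}`-layer of the transform
  have hlayer : ∀ b cz, b + cz = p → cz < p → coeff (mk3 (D - p) b cz) (stepT p l γ g) = 0 := by
    intro b cz hbc hcz
    rw [coeff_stepT_layer hpd hd2 l γ hlow, layerP]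
    refine sum_eq_zero fun b' hb' => ?_
    split_ifs with hle
    · rw [hdef (D - b' - cz) b' cz (by omega) hcz, mul_zero]
    · rfl
  refine ⟨fun a b cz habc hcz => coeff_eq_zero_of_layer_of_stall hpd hd2 hlow' hB' hlayer hlow'' habc hcz, ?_⟩
  rw [coeff_stepT_layer hpd hd2 l γ hlow, layerP, sum_eq_single 0]
  · rw [if_pos (by omega), Nat.choose_zero_right, Nat.cast_one, Nat.sub_zero, pow_zero, one_mul, one_mul, Nat.sub_zero]
  · intro b' hb' hb'0
    split_ifs with hle
    · by_cases h0 : coeff (mk3 (D - b' - p) b' p) g = 0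
      · rw [h0, mul_zero]
      · have h1 := (hB _ h0).1
        simp only [mk3_t] at h1
        omega
    · rfl
  · intro h; exact absurd (mem_range.mpr (by omega)) h

/-- `BDiv R 0` for the difference with the corner monomial. [folklore] -/
theorem bdiv_sub_corner {R p : ℕ} {g : MvPowerSeries (Option (Fin 2)) K} (hB : BDiv R 0 g) (c₀ : K) :
    BDiv R 0 (g - MvPowerSeries.C c₀ * X (some 0) ^ R * X none ^ p) := by
  intro e he
  rw [← mk3_eta e, map_sub, coeff_C_mul_X_pow_mul_X_pow] at he
  refine ⟨?_, Nat.zero_le _⟩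
  by_cases h : e (some 0) = R ∧ e (some 1) = 0 ∧ e none = p
  · exact h.1.ge
  · rw [if_neg h, sub_zero, mk3_eta] at he
    exact (hB e he).1

/-- The inverse of a unit is carried to the inverse by a coefficient map (uniqueness of inverses). [folklore] -/
theorem map_inv_eq {K' : Type*} [Field K'] (ι : K →+* K') {u v : MvPowerSeries (Option (Fin 2)) K} (huv : u * v = 1)
    {v' : MvPowerSeries (Option (Fin 2)) K'} (hv' : MvPowerSeries.map ι u * v' = 1) : MvPowerSeries.map ι v = v' := by
  have h1 : MvPowerSeries.map ι v * MvPowerSeries.map ι u = 1 := by rw [← map_mul, mul_comm, huv, map_one]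
  exact left_inv_eq_right_inv h1 hv'

end Model

/-! ## §2 The shadow anchor -/

section ShadowAnchor

variable {p : ℕ} {Ω : Type} [Field Ω]

/-- **THE SHADOW ANCHOR.** A `w`-anchor `e(f₀) = w · (z^p + f^L)` over `L ↪ Ω` with `f^L ⊗ Ω = g`, and a constant `c₀ ∈ ι(L)`: then
`e(f₀) = (w·u^L) · (z^p + f♯^L)` with `f♯^L ⊗ Ω = (z^p + g)·v − z^p`, `u = 1 + c₀ t^R`, `u v = 1` in `Ω⟦t,y,z⟧` (any such `v`). [folklore] -/
theorem exists_shadow_anchor {C₀ : Type} {L : Type} [Field L] (ι : L →+* Ω) {e : C₀ → MvPowerSeries (Option (Fin 2)) L} {x : C₀}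
    {w fL : MvPowerSeries (Option (Fin 2)) L} (hw : IsUnit w) (hE : e x = w * (X none ^ p + fL)) {g : MvPowerSeries (Option (Fin 2)) Ω}
    (hg : MvPowerSeries.map ι fL = g) {c₀ : Ω} (hc₀ : c₀ ∈ ι.fieldRange) {R : ℕ} (hR : 1 ≤ R) {v : MvPowerSeries (Option (Fin 2)) Ω}
    (huv : (MvPowerSeries.C (1 : Ω) + MvPowerSeries.C c₀ * X (some 0) ^ R) * v = 1) :
    ∃ w' fL' : MvPowerSeries (Option (Fin 2)) L, IsUnit w' ∧ e x = w' * (X none ^ p + fL') ∧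
      MvPowerSeries.map ι fL' = (X none ^ p + g) * v - X none ^ p := by
  obtain ⟨cL, hcL⟩ := hc₀
  have huL : IsUnit (MvPowerSeries.C (1 : L) + MvPowerSeries.C cL * X (some 0) ^ R : MvPowerSeries (Option (Fin 2)) L) :=
    isUnit_one_add_C_mul_X_pow cL hR
  obtain ⟨uL, huLval⟩ := huL
  set uinv : MvPowerSeries (Option (Fin 2)) L := ↑uL⁻¹ with huinv
  have hmul : (↑uL : MvPowerSeries (Option (Fin 2)) L) * uinv = 1 := by rw [huinv, Units.mul_inv]
  refine ⟨w * ↑uL, (X none ^ p + fL) * uinv - X none ^ p, hw.mul (Units.isUnit uL), ?_, ?_⟩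
  · rw [hE]
    linear_combination (-(w * (X none ^ p + fL))) * hmul
  · have hmapu : MvPowerSeries.map ι (↑uL : MvPowerSeries (Option (Fin 2)) L) = MvPowerSeries.C (1 : Ω) + MvPowerSeries.C c₀ * X (some 0) ^ R := by
      rw [huLval, map_one_add_C_mul_X_pow, hcL]
    have hinv : MvPowerSeries.map ι uinv = v := map_inv_eq ι hmul (by rw [hmapu]; exact huv)
    rw [map_sub, map_mul, map_add, map_pow, MvPowerSeries.map_X, hg, hinv]

end ShadowAnchor

/-! ## §2b The degree of a minimal polynomial with an irrational root -/

section MinPoly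

variable {Ω : Type} [Field Ω]

/-- A linear irreducible polynomial over a subfield has its root in the subfield; so a root OUTSIDE the subfield forces degree `≥ 2`. [folklore] -/
theorem two_le_natDegree_of_root_not_mem {Λ : Subfield Ω} {π : Polynomial Λ} (hirr : Irreducible π) {l : Ω}
    (hroot : (π.map Λ.subtype).IsRoot l) (hl : l ∉ Λ) : 2 ≤ π.natDegree := by
  by_contra hlt
  push Not at hlt
  have h1 : 1 ≤ π.natDegree := Polynomial.natDegree_pos_iff_degree_pos.mpr (Polynomial.degree_pos_of_irreducible hirr)
  have hdeg : π.natDegree = 1 := by omega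
  have hform := Polynomial.eq_X_add_C_of_natDegree_le_one (by omega : π.natDegree ≤ 1)
  have ha : π.coeff 1 ≠ 0 := by
    have := Polynomial.leadingCoeff_ne_zero.mpr hirr.ne_zero
    rwa [Polynomial.leadingCoeff, hdeg] at this
  have hev := hroot.eq_zero
  rw [hform, Polynomial.map_add, Polynomial.map_mul, Polynomial.map_C, Polynomial.map_X, Polynomial.map_C, Polynomial.eval_add,
    Polynomial.eval_mul, Polynomial.eval_C, Polynomial.eval_X, Polynomial.eval_C] at hev
  have ha' : (Λ.subtype (π.coeff 1) : Ω) ≠ 0 := fun h => ha (Λ.subtype.injective (by rw [h, map_zero]))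
  have hl' : l = -(Λ.subtype (π.coeff 0)) / (Λ.subtype (π.coeff 1)) := by
    field_simp
    linear_combination hev
  apply hl
  rw [hl']
  exact Λ.div_mem (Λ.neg_mem (π.coeff 0).2) (π.coeff 1).2

end MinPoly

/-! ## §3 Descent of a rational `T`-tail -/

section Descent

variable {p : ℕ} [hp : Fact p.Prime] {K : Type} [Field K] [CharP K p] [PerfectField K]
  {Ω : Type} [Field Ω]

/-- **DESCENT OF A RATIONAL `T`-TAIL; THE DOOR CLOSES IT.** [OURS · L1 W4.6 rung (iii-2)] NOT a statement of the manuscript. A `T`-tail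
`g_{n+1} = stepT p l_n γ_n g_n` (`n ≥ M`) of residuals `g_n ∈ Ω⟦t,y,z⟧` of order `≥ p`, with `γ_n, l_n ∈ Λ_{n+1}`, `l_n ∈ Λ_n ⇒ Λ_{n+1} ≤ Λ_n`,
ALL digits rational (`l_n ∈ Λ_n`), and `g_M` the residual of a `w`-anchor over `L` with `ι(L) = Λ_M` at a singular point of o1's regime, does not
exist: pulled back along `ι` it is a `T`-tail in `L⟦t,y,z⟧` (`…WWalkNRBaseChange.stepT_map`) rooted at the anchor, against pv-5's `false_of_tTail`
and the door in the completion. [cite: StacksProject, Tag 00DV] [cite: Hauser2010, §§F–G] -/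
theorem false_of_rational_tail {A : AmbientDatum p K} {E : IdealExponent A.Z} (hRg : regimeMohWindowSurfaceInsep (p := p) (K := K) A E)
    {ξ : A.Z} (M : ℕ) (g : ℕ → MvPowerSeries (Option (Fin 2)) Ω) (Λ : ℕ → Subfield Ω) (l γ : ℕ → Ω)
    (hAM : ∃ (L : Type) (_ : Field L) (_ : CharP L p) (ι : L →+* Ω)
      (e : AdicCompletion (maximalIdeal (A.Z.presheaf.stalk ξ)) (A.Z.presheaf.stalk ξ) ≃+* MvPowerSeries (Option (Fin 2)) L)
      (f₀ : A.Z.presheaf.stalk ξ) (w fL : MvPowerSeries (Option (Fin 2)) L),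
      ι.fieldRange = Λ M ∧ stalkIdeal E.J ξ = Ideal.span {f₀} ∧ IsUnit w ∧ e (algebraMap _ _ f₀) = w * (X none ^ p + fL) ∧
        MvPowerSeries.map ι fL = g M)
    (hlow : ∀ n, M ≤ n → LowVanish p (g n)) (hstep : ∀ n, M ≤ n → g (n + 1) = stepT p (l n) (γ n) (g n))
    (hΛ : ∀ n, M ≤ n → γ n ∈ Λ (n + 1) ∧ l n ∈ Λ (n + 1) ∧ (l n ∈ Λ n → Λ (n + 1) ≤ Λ n))
    (hrat : ∀ n, M ≤ n → l n ∈ Λ n) : False := by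
  classical
  obtain ⟨L, _iF, _iC, ι, e, f₀, w, fL, hΛM, hJ, hw, hE, hfL⟩ := hAM
  -- all subfields of the tail lie in `Λ M`
  have hΛle : ∀ d, Λ (M + d) ≤ Λ M := by
    intro d
    induction d with
    | zero => exact le_rfl
    | succ d ih => exact ((hΛ (M + d) (by omega)).2.2 (hrat _ (by omega))).trans ih
  have hlmem : ∀ j, l (M + j) ∈ ι.fieldRange := fun j => by
    rw [hΛM]; exact hΛle j (hrat _ (by omega))
  have hγmem : ∀ j, γ (M + j) ∈ ι.fieldRange := fun j => by
    rw [hΛM]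
    have h := (hΛ (M + j) (by omega)).1
    rw [show M + j + 1 = M + (j + 1) by omega] at h
    exact hΛle (j + 1) h
  choose lL hlL using hlmem
  choose γL hγL using hγmem
  -- the pulled-back tail
  let h : ℕ → MvPowerSeries (Option (Fin 2)) L := fun j => Nat.rec fL (fun j hj => stepT p (lL j) (γL j) hj) j
  have h0 : h 0 = fL := rfl
  have hsucc : ∀ j, h (j + 1) = stepT p (lL j) (γL j) (h j) := fun j => rfl
  have hmap : ∀ j, MvPowerSeries.map ι (h j) = g (M + j) := by
    intro j
    induction j with
    | zero => rw [h0, hfL, Nat.add_zero]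
    | succ j ih =>
      rw [hsucc, stepT_map, ih, hlL, hγL, show M + (j + 1) = M + j + 1 by omega]
      exact (hstep (M + j) (by omega)).symm
  have hlowL : ∀ j, LowVanish p (h j) := fun j =>
    (lowVanish_map_iff ι p (h j)).mp (by rw [hmap]; exact hlow _ (by omega))
  refine false_of_tTail (p := p) (fun j => X none ^ p + h j) lL γL (fun j => ?_) (fun j => ?_) ?_
  · show X (some 0) ^ p * (X none ^ p + h (j + 1)) = subst (stepS (lL j) (γL j)) (X none ^ p + h j)
    rw [hsucc]
    exact (subst_stepS_generator (lL j) (γL j) (hlowL j)).symm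
  · show LowVanish p (X none ^ p + h j)
    intro e' he'
    rw [map_add, hlowL j e' he', add_zero, X_pow_eq, coeff_monomial, if_neg]
    intro h'
    rw [h', Finsupp.degree_single] at he'
    exact lt_irrefl _ he'
  · exact exists_door_of_wAnchor hRg e hJ hE

end Descent

end WWalkNR

end CampaignW46

end Summit.ResolutionOfSingularities.ResolutionOfSingularities.Theorems

end
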